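import Summits.PneNP.PneNP.Theorems.CodingVolumeShiftsCodingVolumeRungs

/-!
# Route CodingVolumeShifts — crux `CodingVolume` (stmt-PneNP-19454): the column `C = 3`

`codingVolume_three_mul_card_le_arcCount`: a k-pairs network whose pairs are all at undirected
distance `≥ 3` and which carries a binary one-shot code has at least `3k` arcs — for EVERY degree
bound (none is used), improving the last-middle-arc rung `(2Δ+1)·k ≤ Δ·m` of
`CodingVolumeShiftsCodingVolumeRungs` and matching the ceiling `C ≤ L`
(`CodingVolume.Negative.codingVolume_ceiling`): the cell `(Δ, C) = (Δ, 3)` of X = `CodingVolume`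
holds with the optimal `L = 3` (`codingVolume_rung_three`, crux-shaped). With `codingVolume_rung_two`
and `codingVolume_column_degOne` the open cells of the ladder are now `Δ ≥ 2, C ≥ 4`.

Proof (three pairwise disjoint arc classes, each of size counted against `k`):
1. `codingVolume_exists_source_arc_to_middle` — every source has an out-arc whose head is a tail
   (a middle vertex): follow the chain of `x_i`-dependent arcs upstream from `sink i`; it ends at
   `source i` after `≥ 2` steps (`Far ≥ 2`). `k` arcs with source tails and non-sink heads.
2. Arcs INTO sinks: `Σ_i indeg(t_i) ≥ k + #(non-pure i)`, where sink `i` is PURE AT `w` when all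
   its in-arcs leave the single vertex `w`; a non-pure sink has two in-arcs with distinct tails.
3. `codingVolume_card_pure_le_middle_inArcs` — for every vertex `w`, the arcs into `w` from
   NON-sources are at least the sinks pure at `w`: hard-wire all other inputs; the bits on those
   arcs determine every bit leaving `w` (a source `s_l` adjacent into `w` or equal to `w` has
   `l` not pure at `w`, else `s_l, w, t_l` would be a walk of length `≤ 2` — this is where `Far 3`
   is used), hence the pure sinks' bits: an injection `Bool^{P_w} ↪ Bool^{MMin(w)}`. Summing over
   `w` (disjoint arc sets, heads `w` non-sinks, tails non-sources) gives `≥ #(pure i)` further arcs.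
Total `k + (k + #non-pure) + #pure = 3k`. No definitions; "pure" and "depends on `x_i`" are
spelled out inline. Route-independent (no Theses import).
-/

set_option linter.dupNamespace false -- `Summit.PneNP.PneNP.…`: summit = sub-problem name (D-0017)

namespace Summit.PneNP.PneNP.Theorems

open Literature.InformationTheory.NetworkCoding Finset

section ColumnThree

variable {ι : Type} {N : KPairsNet ι}

/-- Upstream of any `x_i`-dependent arc `b` there is an arc leaving `source i` which is either `b`
itself or has a head that is the tail of some arc. (Rank induction on
`codingVolume_dep_upstream`.) [folklore] -/
theorem codingVolume_exists_source_arc_of_dep (c : N.Code) (i : ι) (b : N.A)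
    (hb : ¬ ∀ x x' : ι → Bool, (∀ j, j ≠ i → x j = x' j) → c.val b x = c.val b x') :
    ∃ a, N.src a = N.source i ∧ (a = b ∨ ∃ b', N.src b' = N.tgt a) := by
  suffices h : ∀ (r : ℕ) (b : N.A), N.rank (N.src b) = r →
      (¬ ∀ x x' : ι → Bool, (∀ j, j ≠ i → x j = x' j) → c.val b x = c.val b x') →
      ∃ a, N.src a = N.source i ∧ (a = b ∨ ∃ b', N.src b' = N.tgt a) from h _ b rfl hb
  intro r
  induction r using Nat.strong_induction_on with
  | _ r ih =>
    intro b hr hdep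
    rcases codingVolume_dep_upstream c i b hdep with hsrc | ⟨b1, hb1, hdep1⟩
    · exact ⟨b, hsrc, Or.inl rfl⟩
    · have hlt : N.rank (N.src b1) < r := by
        rw [← hr, ← hb1]; exact N.rank_lt b1
      obtain ⟨a, ha, h⟩ := ih _ hlt b1 rfl hdep1
      refine ⟨a, ha, Or.inr ?_⟩
      rcases h with h | h
      · exact ⟨b, by rw [h, hb1]⟩
      · exact h

/-- FIRST ARCS LAND IN THE MIDDLE. If `source i`, `sink i` are at undirected distance `≥ 2`, then
`source i` has an out-arc whose head is the tail of some arc (so the head is neither a source nor a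
sink). [folklore] -/
theorem codingVolume_exists_source_arc_to_middle (c : N.Code) (i : ι)
    (hfar : (2 : ℕ∞) ≤ N.graph.edist (N.source i) (N.sink i)) :
    ∃ a, N.src a = N.source i ∧ ∃ b', N.src b' = N.tgt a := by
  obtain ⟨b, hb, hdep⟩ := codingVolume_exists_dep_inArc_sink c i
  obtain ⟨a, ha, h⟩ := codingVolume_exists_source_arc_of_dep c i b hdep
  rcases h with h | h
  · exfalso
    have hadj : N.graph.Adj (N.source i) (N.sink i) := by
      rw [← ha, ← hb, h]; exact codingVolume_adj_arc _
    have h1 := codingVolume_le_length_of_far (L := 2) (by exact_mod_cast hfar)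
      (SimpleGraph.Walk.cons hadj SimpleGraph.Walk.nil)
    simp at h1
  · exact ⟨a, ha, h⟩

/-- PURE SINKS NEED MIDDLE IN-ARCS (the step that uses distance `3`). Call sink `i` *pure at* `w`
when every arc into `sink i` leaves `w`. For every vertex `w` of a `3`-far coded network, the arcs
into `w` whose tail is not a source are at least as many as the commodities pure at `w`:
hard-wiring all other inputs to `false`, the bits on those arcs determine all bits leaving `w`
(a source adjacent into `w`, or sitting at `w`, owns no commodity pure at `w` — its sink would be
within distance `2`), hence the bits of the pure commodities; an injection
`Bool^{pure} ↪ Bool^{arcs}`. [folklore] -/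
theorem codingVolume_card_pure_le_middle_inArcs [Fintype ι] (c : N.Code) (hfar : N.Far 3)
    (w : N.V) :
    (univ.filter fun i => ∀ b, N.tgt b = N.sink i → N.src b = w).card ≤
      (univ.filter fun a => N.tgt a = w ∧ ∀ l, N.src a ≠ N.source l).card := by
  classical
  set P : Finset ι := univ.filter fun i => ∀ b, N.tgt b = N.sink i → N.src b = w with hP
  set Q : Finset N.A := univ.filter fun a => N.tgt a = w ∧ ∀ l, N.src a ≠ N.source l with hQ
  let ext : ({i // i ∈ P} → Bool) → (ι → Bool) :=
    fun y j => if h : j ∈ P then y ⟨j, h⟩ else false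
  let φ : ({i // i ∈ P} → Bool) → ({a // a ∈ Q} → Bool) := fun y a => c.val a.1 (ext y)
  -- a source sitting at `w` or adjacent into `w` owns no commodity pure at `w`
  have hnotP : ∀ l, (N.source l = w ∨ ∃ b, N.src b = N.source l ∧ N.tgt b = w) → l ∉ P := by
    intro l hl hlP
    rw [hP, Finset.mem_filter] at hlP
    obtain ⟨b0, hb0, -⟩ := codingVolume_exists_dep_inArc_sink c l
    have hsrc : N.src b0 = w := hlP.2 b0 hb0
    have hadj2 : N.graph.Adj w (N.sink l) := by
      rw [← hsrc, ← hb0]; exact codingVolume_adj_arc _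
    rcases hl with hl | ⟨b, hb, hbw⟩
    · have h1 := codingVolume_le_length_of_far (L := 3) (by exact_mod_cast hfar l)
        ((SimpleGraph.Walk.cons hadj2 SimpleGraph.Walk.nil).copy hl.symm rfl)
      simp at h1
    · have hadj1 : N.graph.Adj (N.source l) w := by
        rw [← hb, ← hbw]; exact codingVolume_adj_arc _
      have h1 := codingVolume_le_length_of_far (L := 3) (by exact_mod_cast hfar l)
        (SimpleGraph.Walk.cons hadj1 (SimpleGraph.Walk.cons hadj2 SimpleGraph.Walk.nil))
      simp at h1
  have hφ : Function.Injective φ := by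
    intro y y' h
    -- the arcs into `w` carry the same bits on `ext y` and `ext y'`
    have hin : ∀ b, N.tgt b = w → c.val b (ext y) = c.val b (ext y') := by
      intro b hb
      by_cases hs : ∃ l, N.src b = N.source l
      · obtain ⟨l, hl⟩ := hs
        refine c.local_ b _ _ (fun b' hb' => absurd (hb'.trans hl) (N.source_in b' l))
          (fun l' hl' => ?_)
        have hll : l' = l := N.source.injective (hl'.trans hl)
        subst hll
        have hl'P : l' ∉ P := hnotP l' (Or.inr ⟨b, hl, hb⟩)
        simp [ext, hl'P]
      · push Not at hs
        have hbQ : b ∈ Q := by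
          rw [hQ, Finset.mem_filter]; exact ⟨Finset.mem_univ _, hb, hs⟩
        exact congrFun h ⟨b, hbQ⟩
    -- hence so do the arcs out of `w`
    have hout : ∀ a, N.src a = w → c.val a (ext y) = c.val a (ext y') := by
      intro a ha
      refine c.local_ a _ _ (fun b hb => hin b (hb.trans ha)) (fun l hl => ?_)
      have hlP : l ∉ P := hnotP l (Or.inl (hl.trans ha))
      simp [ext, hlP]
    funext ⟨i, hi⟩
    have hiP := hi
    rw [hP, Finset.mem_filter] at hiP
    have key := c.decode i (ext y) (ext y') (fun b hb => hout b (hiP.2 b hb))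
    simpa [ext, hi] using key
  have h2 : 2 ^ P.card ≤ 2 ^ Q.card := by
    simpa [Fintype.card_fun, Fintype.card_bool, Fintype.card_coe] using
      Fintype.card_le_of_injective φ hφ
  exact (Nat.pow_le_pow_iff_right (by norm_num)).1 h2

/-- **Column `C = 3` of `CodingVolume` (arc form), no degree bound.** A k-pairs network with all
pairs at undirected distance `≥ 3` carrying a binary one-shot code has at least `3k` arcs: the `k`
first arcs of the sources (heads in the middle), the arcs into sinks (`≥ k + #non-pure`), and the
non-source arcs into vertices owning pure sinks (`≥ #pure`) are pairwise disjoint. [folklore] -/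
theorem codingVolume_three_mul_card_le_arcCount [Fintype ι] (N : KPairsNet ι) (hfar : N.Far 3)
    (c : N.Code) : 3 * Fintype.card ι ≤ N.arcCount := by
  classical
  have hfar2 : N.Far 2 := fun i =>
    le_trans (by exact_mod_cast (by norm_num : (2 : ℕ) ≤ 3)) (hfar i)
  set A1 : Finset N.A :=
    univ.filter fun a => (∃ i, N.src a = N.source i) ∧ ∃ b', N.src b' = N.tgt a with hA1
  set A2 : Finset N.A := univ.filter fun a => ∃ i, N.tgt a = N.sink i with hA2
  set A3 : Finset N.A := univ.filter fun a =>
    (∀ l, N.src a ≠ N.source l) ∧ ∃ i, ∀ b, N.tgt b = N.sink i → N.src b = N.tgt a with hA3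
  have hin : ∀ i, ∃ b, N.tgt b = N.sink i := fun i =>
    (codingVolume_exists_dep_inArc_sink c i).imp fun _ hb => hb.1
  -- pairwise disjoint
  have h12 : Disjoint A1 A2 := by
    rw [hA1, hA2, Finset.disjoint_filter]
    rintro a - ⟨-, b', hb'⟩ ⟨i, hi⟩
    exact N.sink_out b' i (hb'.trans hi)
  have h13 : Disjoint A1 A3 := by
    rw [hA1, hA3, Finset.disjoint_filter]
    rintro a - ⟨⟨i, hi⟩, -⟩ ⟨hns, -⟩
    exact hns i hi
  have h23 : Disjoint A2 A3 := by
    rw [hA2, hA3, Finset.disjoint_filter]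
    rintro a - ⟨i, hi⟩ ⟨-, j, hj⟩
    obtain ⟨b, hb⟩ := hin j
    exact N.sink_out b i ((hj b hb).trans hi)
  -- (1) first arcs
  have h1 : Fintype.card ι ≤ A1.card := by
    choose f hf hf' using fun i => codingVolume_exists_source_arc_to_middle c i (hfar2 i)
    rw [← Finset.card_univ]
    refine Finset.card_le_card_of_injOn f (fun i _ => ?_) (fun i _ i' _ h => ?_)
    · rw [Finset.mem_coe, hA1, Finset.mem_filter]
      exact ⟨Finset.mem_univ _, ⟨i, hf i⟩, hf' i⟩
    · exact N.source.injective ((hf i).symm.trans ((congrArg N.src h).trans (hf i')))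
  -- (2) arcs into sinks
  set Pr : Finset ι := univ.filter fun i => ∃ w, ∀ b, N.tgt b = N.sink i → N.src b = w with hPr
  have h2 : 2 * Fintype.card ι ≤ A2.card + Pr.card := by
    have hA2eq : A2 = (univ : Finset ι).biUnion fun i => N.inArcs (N.sink i) := by
      ext a
      simp [hA2, KPairsNet.inArcs]
    have hdisj : (↑(univ : Finset ι) : Set ι).PairwiseDisjoint fun i => N.inArcs (N.sink i) := by
      intro i _ j _ hij
      rw [Function.onFun, Finset.disjoint_left]
      intro a hai haj
      simp only [KPairsNet.inArcs, Finset.mem_filter, Finset.mem_univ, true_and] at hai haj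
      exact hij (N.sink.injective (hai.symm.trans haj))
    have hper : ∀ i, (if i ∈ Pr then 1 else 2) ≤ (N.inArcs (N.sink i)).card := by
      intro i
      obtain ⟨b, hb⟩ := hin i
      have hbm : b ∈ N.inArcs (N.sink i) := by simp [KPairsNet.inArcs, hb]
      split_ifs with hp
      · exact Finset.card_pos.mpr ⟨b, hbm⟩
      · by_contra hlt
        push Not at hlt
        apply hp
        rw [hPr, Finset.mem_filter]
        refine ⟨Finset.mem_univ _, N.src b, fun b' hb' => ?_⟩
        have hb'm : b' ∈ N.inArcs (N.sink i) := by simp [KPairsNet.inArcs, hb']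
        rw [Finset.card_le_one.mp (by omega) b' hb'm b hbm]
    have hsum : ∑ i : ι, (if i ∈ Pr then 1 else 0) = Pr.card := by
      rw [Finset.sum_ite_mem, Finset.univ_inter, Finset.card_eq_sum_ones]
    calc 2 * Fintype.card ι = ∑ _i : ι, 2 := by simp [mul_comm]
      _ = ∑ i : ι, ((if i ∈ Pr then 1 else 2) + (if i ∈ Pr then 1 else 0)) := by
          refine Finset.sum_congr rfl fun i _ => ?_
          split_ifs <;> rfl
      _ = ∑ i : ι, (if i ∈ Pr then 1 else 2) + ∑ i : ι, (if i ∈ Pr then 1 else 0) :=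
          Finset.sum_add_distrib
      _ ≤ ∑ i : ι, (N.inArcs (N.sink i)).card + Pr.card :=
          add_le_add (Finset.sum_le_sum fun i _ => hper i) hsum.le
      _ = A2.card + Pr.card := by rw [hA2eq, Finset.card_biUnion hdisj]
  -- (3) middle in-arcs of the owners of pure sinks
  have h3 : Pr.card ≤ A3.card := by
    set W : Finset N.V := univ.filter fun w => ∃ i, ∀ b, N.tgt b = N.sink i → N.src b = w with hW
    have hPr_eq : Pr = W.biUnion fun w =>
        univ.filter fun i => ∀ b, N.tgt b = N.sink i → N.src b = w := by
      ext i
      simp only [hPr, hW, Finset.mem_filter, Finset.mem_univ, true_and, Finset.mem_biUnion]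
      constructor
      · rintro ⟨w, hw⟩
        exact ⟨w, ⟨i, hw⟩, hw⟩
      · rintro ⟨w, -, hw⟩
        exact ⟨w, hw⟩
    have hsub : W.biUnion (fun w => univ.filter fun a => N.tgt a = w ∧ ∀ l, N.src a ≠ N.source l)
        ⊆ A3 := by
      intro a ha
      rw [Finset.mem_biUnion] at ha
      obtain ⟨w, hw, ha⟩ := ha
      rw [hW, Finset.mem_filter] at hw
      rw [Finset.mem_filter] at ha
      rw [hA3, Finset.mem_filter]
      obtain ⟨i, hi⟩ := hw.2
      exact ⟨Finset.mem_univ _, ha.2.2, i, by rw [ha.2.1]; exact hi⟩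
    have hdisjQ : (↑W : Set N.V).PairwiseDisjoint
        (fun w => univ.filter fun a => N.tgt a = w ∧ ∀ l, N.src a ≠ N.source l) := by
      intro w _ w' _ hww
      rw [Function.onFun, Finset.disjoint_filter]
      rintro a - ⟨h1, -⟩ ⟨h2, -⟩
      exact hww (h1.symm.trans h2)
    calc Pr.card
        = (W.biUnion fun w => univ.filter fun i => ∀ b, N.tgt b = N.sink i → N.src b = w).card := by
          rw [hPr_eq]
      _ ≤ ∑ w ∈ W, (univ.filter fun i => ∀ b, N.tgt b = N.sink i → N.src b = w).card :=
          Finset.card_biUnion_le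
      _ ≤ ∑ w ∈ W, (univ.filter fun a => N.tgt a = w ∧ ∀ l, N.src a ≠ N.source l).card :=
          Finset.sum_le_sum fun w _ => codingVolume_card_pure_le_middle_inArcs c hfar w
      _ = (W.biUnion fun w =>
            univ.filter fun a => N.tgt a = w ∧ ∀ l, N.src a ≠ N.source l).card :=
          (Finset.card_biUnion hdisjQ).symm
      _ ≤ A3.card := Finset.card_le_card hsub
  -- total
  have hunion : A1.card + A2.card + A3.card ≤ N.arcCount := by
    have hd : Disjoint (A1.disjUnion A2 h12) A3 := by
      rw [Finset.disjoint_left]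
      intro a ha ha3
      rcases Finset.mem_disjUnion.mp ha with h | h
      · exact Finset.disjoint_left.mp h13 h ha3
      · exact Finset.disjoint_left.mp h23 h ha3
    calc A1.card + A2.card + A3.card = ((A1.disjUnion A2 h12).disjUnion A3 hd).card := by
          rw [Finset.card_disjUnion, Finset.card_disjUnion]
      _ ≤ Fintype.card N.A := Finset.card_le_univ _
      _ = N.arcCount := rfl
  omega

/-- **Column `C = 3` of `CodingVolume` (crux stmt-PneNP-19454) in the shape of the crux:** for
every degree bound `Δ` the distance `L = 3` forces `3k ≤ m` (optimal by
`CodingVolume.Negative.codingVolume_ceiling`). [folklore] -/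
theorem codingVolume_rung_three : ∀ Δ : ℕ, ∃ L : ℕ, ∀ (ι : Type) [Fintype ι] (N : KPairsNet ι),
    N.DegLE Δ → N.Far L → Nonempty N.Code → 3 * Fintype.card ι ≤ N.arcCount :=
  fun _ => ⟨3, fun _ _ N _ hfar hc => hc.elim fun c => codingVolume_three_mul_card_le_arcCount N hfar c⟩

end ColumnThree

end Summit.PneNP.PneNP.Theorems
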